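import Literature.NumberTheory.GelbartRogawski1991.DoubledWeilRepresentationCMExplicit      -- ★ `cmDoubledWeilRep`, `eq_cmDoubledWeilRep_of_isDoubledWeilRep`, `cmDoubledWeilRep_locToAdelic`, `cmFinLocalFamily`
import Literature.NumberTheory.GelbartRogawski1991.DoubledWeilRepresentationArchHalf        -- ★ `exists_isArchHalf`
import Summits.HodgeConjecture.HodgeConjecture.Theorems.K2LiuSiegelWeilTensorGenerator       -- ★ p856984 (O42.3g) §1 `swSectionTensor_mul_right` (+ ★ O42.3b `swSectionTensor`)
import Summits.HodgeConjecture.HodgeConjecture.Theorems.K2LiuTensorEmbPlaceComponents        -- ★ p857534 (T2-a) `exists_mem_localInt_tensorEmb_inclPlaceAdelic`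
import HarnessLib

/-!
# The Siegel–Weil section of an `M₂`-frame is spherical at almost every place (organ T2-e of the #42S «SPAN» road)

Track B ∕ hLiu418 = stmt-HodgeConjecture-24832, line `K2_Liu_CurveThetaSigs`; LEAD F0P6-plan (g11) rulings «M-155j» §3 («then T2»), «M-155k» (5)(7)(9)
(GO 05:01:10Z: «`∀ᶠ v in cofinite, ∀ u ∈ localInt v, Φ_v = 𝟙 factorwise → swSectionTensor sB Φ (h * inclPlaceAdelic v u) = swSectionTensor sB Φ h`,
any `hsB`»); census `K2/K2Liu-p03/g4/CENSUS-T2-SphericalSWValue.K2Liu-p03-g4.md`; seat `hodgecm-mathlib-K2Liu-p03` (g4).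

WHAT.  For the restricted-tensor-product plumbing of the SPAN socket (#42S S4) the generators `f_Φ^{V′} = swSectionTensor sB Φ` (★ O42.3b:
`f_Φ^{V′}(h) = (ω(r_F(δ′))·ω(sB(h ⊗ 1_{V′})) Φ)(0)`) must be right-invariant under the good maximal compact `K_{H,v} = U(𝔻)(𝒪_v)` at almost
every finite place `v` of `L⁺` whenever `Φ = Φ_∞ ⊗ (⊗_w Φ_w)` is a pure tensor with `Φ_v = 1_{𝒪_v^{n′+n′}}`.  Since `f(h·k) = f_{ω(sB(k ⊗ 1))Φ}(h)`
(★ `swSectionTensor_mul_right`), this is a FIXED-VECTOR statement for the doubled Weil representation of the BIG datum `(dV, dW ⊗ dV′)`: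

* §1 (any unitary datum `F, E, c, N, J = T ⊗ E`, any restricted family `𝓢` of local splittings, ★ `FiniteAdelicSplittingAssembly`)
  `Omega_inclPlace_piProdSB`: for almost all `v`, `Ω(ι_v u) (⊗_w Φ_w) = ⊗_w Φ_w` for `u ∈ U(J)(𝒪_v)` and `Φ_v = 1_{𝒪_vᴺ}` (★ `Omega_piProdSB` slot by
  slot, ★ `evalPlace_inclPlace[_of_ne]`, the unramified clause ★ `unitVec_mem_fixedPoints`); `omega_finSplitting_inclPlace_tmul`: the same for
  `ω(s_f(ι_v u))` on `Φ_∞ ⊗ (⊗_w Φ_w)` (★ `omega_finSplitting_tmul`);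
* §2 (the doubled CM datum `(dV, dW, e)` of ★ `DoubledUnitaryGlobalSplittingData`) `omega_locToAdelic_tmul_of_isDoubledWeilRep`: for EVERY
  `χ`-normalised doubled Weil representation `sD` (★ `IsDoubledWeilRep χ sD`, `χ` unitary with `χ|_{𝕀_{L⁺}} = ε`), for almost all `v`,
  `ω(sD(ι_v u)) (Φ_∞ ⊗ ⊗_w Φ_w) = Φ_∞ ⊗ ⊗_w Φ_w` for `u ∈ U(𝔻)(𝒪_v)`, `Φ_v = 𝟙` — by UNIQUENESS (★ `eq_cmDoubledWeilRep_of_isDoubledWeilRep`,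
  [Kudla1996 I §6 Lemma 6.3]) `sD` is the explicit representation ★ `cmDoubledWeilRep`, whose value at `ι_v u = locToAdelic v u` is the finite half
  `⊗'_w s_w` at `inclPlace v u` (★ `cmDoubledWeilRep_locToAdelic`, ★ `finHalf_eq_finSplitting`), and §1 applies to ★ `finSplittings (cmFinLocalFamily χ)`;
* §3 (the big datum `(dV, tensorFrame dW eW dV′, e′)` read along ★ `tensorEmb`) `omega_tensorEmb_locToAdelic_tmul_of_isDoubledWeilRep`:
  `ω(sB((ι_v u) ⊗ 1)) Φ = Φ` — ★ T2-a `exists_mem_localInt_tensorEmb_inclPlaceAdelic` (`(ι_v u) ⊗ 1 = ι_v u′`, `u′ ∈ U(𝔻 ⊗ V′)(𝒪_v)`) + §2; and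
  THE HEAD **`swSectionTensor_mul_locToAdelic_of_isDoubledWeilRep`**:
    `∀ᶠ v in cofinite, ∀ u ∈ U(𝔻)(𝒪_v), ∀ Φ_∞ Y, Y v = 1_{𝒪_v} → ∀ h, f_{Φ_∞ ⊗ ⊗Y}^{V′}(h · ι_v u) = f_{Φ_∞ ⊗ ⊗Y}^{V′}(h)`
  (the cofinite set depends on `sB` only — uniform in `Φ`), with the corollaries `…_eventually` (no `Φ_v = 𝟙` binder: a restricted family IS
  `𝟙` almost everywhere, ★ `RestrictedFamily.eventually_eq`) and `swSectionTensor_doubledWeilRep_mul_locToAdelic` (the representation of record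
  ★ `doubledWeilRep χ`).

Binder conventions for the SPAN typist (ED. 11): `ι_v u` is ★ `GRConstruction.locToAdelic v u : H(𝔸)` (= ★ `UnitaryGroup.inclPlaceAdelic v u`
definitionally, typed in `HA` so that `h * locToAdelic v u` elaborates); «`Φ_v = 𝟙` factorwise» is `Φ = piSchwartzBruhatEquiv (Φ_∞ ⊗ₜ piProdSB Y)`
with `Y : LocalSBFamily (Fp L) (Fin (n′+n′))`, `Y v = unitVec (Fp L) (Fin (n′+n′)) v`; the place set is `∀ᶠ v in Filter.cofinite` (no named
finite set: the exceptional places of `cmFinLocalFamily χ` are not data of the tree).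
[cite: GelbartRogawski1991, §3.1 (3.1.3) p. 456] [cite: Weil1964, Chap. III n° 37–38 pp. 188–190] [cite: KudlaRallis1994, §1] [cite: HarrisKudlaSweet1996, §1 (1.16)]
[cite: MoeglinVignerasWaldspurger1987, Chap. 5 I.4] [cite: Kudla1996, Chap. I §6 Lemma 6.3]

Mathlib + ★ only: no definition, no instance, no named-fact hypothesis, no `sorry`; axioms ⊆ {propext, Classical.choice, Quot.sound}.

## References
* [GelbartRogawski1991] S. Gelbart, J. Rogawski, Invent. Math. 105 (1991), §3.1 (3.1.3) p. 456 (unramified clause of the splitting).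
* [Weil1964] A. Weil, Acta Math. 111 (1964), Chap. III n° 37–38 (restricted products of Weil representations).
* [KudlaRallis1994] S. Kudla, S. Rallis, Ann. of Math. 140 (1994), §1 (Siegel–Weil sections `Φ ↦ f_Φ`, `Φ°` spherical).
* [HarrisKudlaSweet1996] M. Harris, S. Kudla, W. J. Sweet, J. AMS 9 (1996), §1 (1.16).
* [MoeglinVignerasWaldspurger1987] C. Mœglin, M.-F. Vignéras, J.-L. Waldspurger, LNM 1291, Chap. 5 I.4 (unramified Weil representation).
* [Kudla1996] S. Kudla, *Notes on the local theta correspondence* (1996), Chap. I §6 Lemma 6.3 (uniqueness of the splitting normalisation).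

HONEST LABEL: HC_CM is proved only modulo the 7 printed citations (2 remaining named inputs: hLiu418 = stmt-HodgeConjecture-24832, h413 =
stmt-HodgeConjecture-24833) until rung 0 closes; this helper moves no counter.
-/

set_option autoImplicit false

set_option linter.dupNamespace false

noncomputable section

open scoped Matrix Kronecker TensorProduct Classical
open NumberField NumberField.mixedEmbedding IsDedekindDomain Filter

namespace Summit.HodgeConjecture.HodgeConjecture.Cruxes.HLiu418.K2LiuSphericalSWSectionTensor

open Literature.NumberTheory.Automorphic Literature.NumberTheory.Automorphic.UnitaryGroup Literature.NumberTheory.GaloisRepresentations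
open Literature.NumberTheory.Weil1964 Literature.RepresentationTheory.HarrisKudlaSweet1996
open Literature.NumberTheory.GelbartRogawski1991 Literature.NumberTheory.GelbartRogawski1991.GRConstruction
open Literature.NumberTheory.GelbartRogawski1991.UnitaryDualPair.LocalSplitting (FinLocalSplittings)
open Literature.NumberTheory.Automorphic.Liu2021.Def411WeilCarriersDoubling
open Literature.NumberTheory.K2Lit.SiegelDoubled
open Summit.HodgeConjecture.HodgeConjecture.Cruxes.HLiu418.K2LiuSiegelWeilTensorGenerator (swSectionTensor_mul_right)
open Summit.HodgeConjecture.HodgeConjecture.Cruxes.HLiu418.K2LiuTensorEmbPlaceComponents (exists_mem_localInt_tensorEmb_inclPlaceAdelic)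

/-! ## §1 Any restricted family of local splittings: `Ω(ι_v u)` fixes pure tensors with `Φ_v = 𝟙` at almost every `v` -/

section Generic

variable {F : Type} [Field F] [NumberField F] {E : Type} [Field E] [NumberField E] [Algebra F E]
  [Algebra.IsQuadraticExtension F E] {c : E ≃ₐ[F] E} {N : ℕ} {δ : E} {hcδ : c δ = -δ} {hδ : δ ≠ 0} {d : F}
  {hd : δ * δ = algebraMap F E d} {T : Matrix (Fin N) (Fin N) F} {hT : T.IsSymm}
  {J : Matrix (Fin N) (Fin N) E} {hJ : J = T.map (algebraMap F E)}

/-- **`Ω(ι_v u) (⊗_w Φ_w) = ⊗_w Φ_w`** for almost all `v`, all `u ∈ U(J)(𝒪_v)` and all pure tensors with `Φ_v = 1_{𝒪_vᴺ}`: slot by slot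
(★ `Omega_piProdSB`), `(ι_v u)_w = 1` for `w ≠ v` (★ `evalPlace_inclPlace_of_ne`) and `ω_v(u) 1_{𝒪_vᴺ} = 1_{𝒪_vᴺ}` at the good places of `𝓢`
(★ `unitVec_mem_fixedPoints`). [cite: GelbartRogawski1991, §3.1 (3.1.3) p. 456] [cite: Weil1964, Chap. III n° 37–38 pp. 188–190] -/
theorem Omega_inclPlace_piProdSB (𝓢 : FinLocalSplittings F E c N hcδ hδ hd T hT hJ) :
    ∀ᶠ v in Filter.cofinite, ∀ u ∈ UnitaryGroup.localInt E c N J v, ∀ Y : LocalSBFamily F (Fin N),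
      Y v = unitVec F (Fin N) v →
        𝓢.Omega (UnitaryGroup.inclPlace F E c N J v u) (piProdSB F (Fin N) Y) = piProdSB F (Fin N) Y :=
  𝓢.unitVec_mem_fixedPoints.mono fun v hv u hu Y hY => by
    refine (𝓢.Omega_piProdSB _ _).trans (congrArg (piProdSB F (Fin N)) (RestrictedProduct.ext _ _ fun w => ?_))
    rw [FinLocalSplittings.smul_apply]
    rcases eq_or_ne w v with rfl | hw
    · rw [UnitaryGroup.evalPlace_inclPlace, hY]
      exact ((𝓢.omegaLoc _).mem_fixedPoints _ _).1 hv u hu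
    · rw [UnitaryGroup.evalPlace_inclPlace_of_ne F E c N J hw, map_one, Module.End.one_apply]

/-- **`ω(s_f(ι_v u)) (Φ_∞ ⊗ ⊗_w Φ_w) = Φ_∞ ⊗ ⊗_w Φ_w`** under the same binders: the operators of the finite half are `1 ⊗ Ω(g)`
(★ `omega_finSplitting_tmul`). [cite: Weil1964, Chap. III n° 37–38 pp. 188–190] [cite: GelbartRogawski1991, §3.1 (3.1.3) p. 456] -/
theorem omega_finSplitting_inclPlace_tmul (𝓢 : FinLocalSplittings F E c N hcδ hδ hd T hT hJ) :
    ∀ᶠ v in Filter.cofinite, ∀ u ∈ UnitaryGroup.localInt E c N J v,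
      ∀ (Φinf : SchwartzMap (Fin N → mixedSpace F) ℂ) (Y : LocalSBFamily F (Fin N)), Y v = unitVec F (Fin N) v →
        adelicMpCont.omega F (Fin N) (T.map (algebraMap F (AdeleRing (𝓞 F) F)))
            (𝓢.finSplitting (UnitaryGroup.inclPlace F E c N J v u))
            (piSchwartzBruhatEquiv F (Fin N) (Φinf ⊗ₜ piProdSB F (Fin N) Y)) =
          piSchwartzBruhatEquiv F (Fin N) (Φinf ⊗ₜ piProdSB F (Fin N) Y) :=
  (Omega_inclPlace_piProdSB 𝓢).mono fun v hv u hu Φinf Y hY => by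
    rw [𝓢.omega_finSplitting_tmul, hv u hu Y hY]

end Generic

/-! ## §2 The doubled CM datum: every `χ`-normalised doubled Weil representation is spherical at almost every place -/

variable (L : Type) [Field L] [NumberField L] [IsCMField L]
variable {N M n : ℕ} (e : Fin N × Fin M ≃ Fin n)
  (dV : Fin N → L) (hdV : ∀ i, IsCMField.complexConj L (dV i) = dV i) (hdV0 : ∀ i, dV i ≠ 0)
  (dW : Fin M → L) (hdW : ∀ i, IsCMField.complexConj L (dW i) = dW i) (hdW0 : ∀ i, dW i ≠ 0)

/-- **`ω(sD(ι_v u)) (Φ_∞ ⊗ ⊗_w Φ_w) = Φ_∞ ⊗ ⊗_w Φ_w`** for almost all `v`, all `u ∈ U(𝔻)(𝒪_v)`, all pure tensors with `Φ_v = 𝟙`, for EVERY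
`χ`-normalised doubled Weil representation `sD` of the doubled CM datum: by uniqueness `sD` is ★ `cmDoubledWeilRep χ` (any Haar data, any
archimedean half — one exists, ★ `exists_isArchHalf`), whose value at `ι_v u` is the finite half at `inclPlace v u` (★ `cmDoubledWeilRep_locToAdelic`,
★ `finHalf_eq_finSplitting`); then §1 for ★ `finSplittings (cmFinLocalFamily χ)`.
[cite: GelbartRogawski1991, §3.1 (3.1.3) p. 456] [cite: Kudla1996, Chap. I §6 Lemma 6.3] [cite: MoeglinVignerasWaldspurger1987, Chap. 5 I.4] -/
theorem omega_locToAdelic_tmul_of_isDoubledWeilRep {χ : HeckeCharacter L} (hχu : χ.IsUnitary) (hχs : IsSplittingChar L 1 χ)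
    {sD : HA L e dV hdV dW hdW →* MpD L e dV hdV dW hdW} (hsD : IsDoubledWeilRep L e dV hdV hdV0 dW hdW hdW0 χ sD) :
    ∀ᶠ v in Filter.cofinite, ∀ u ∈ UnitaryGroup.localInt L (IsCMField.complexConj L) (n + n) (hermD L e dV hdV dW hdW) v,
      ∀ (Φinf : SchwartzMap (Fin (n + n) → mixedSpace (Fp L)) ℂ) (Y : LocalSBFamily (Fp L) (Fin (n + n))),
        Y v = unitVec (Fp L) (Fin (n + n)) v →
          adelicMpCont.omega (Fp L) (Fin (n + n)) (gramDA L e dV hdV dW hdW) (sD (locToAdelic L e dV hdV dW hdW v u))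
              (piSchwartzBruhatEquiv (Fp L) (Fin (n + n)) (Φinf ⊗ₜ piProdSB (Fp L) (Fin (n + n)) Y)) =
            piSchwartzBruhatEquiv (Fp L) (Fin (n + n)) (Φinf ⊗ₜ piProdSB (Fp L) (Fin (n + n)) Y) := by
  -- an archimedean half (no `obtain`: destructuring the `∃` over the `Mp(𝕎^𝔻)ᶜᵒⁿᵗ`-valued homomorphisms times out)
  have ha := Classical.choose_spec (exists_isArchHalf L e dV hdV hdV0 dW hdW hdW0 χ hχu hχs)
  have H := omega_finSplitting_inclPlace_tmul
    (finSplittings L e dV hdV hdV0 dW hdW hdW0 χ (borelPlaceMeasure L)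
      (cmFinLocalFamily L e dV hdV hdV0 dW hdW hdW0 χ hχs (borelPlaceMeasure L)))
  refine H.mono fun v hv u hu Φinf Y hY => ?_
  rw [eq_cmDoubledWeilRep_of_isDoubledWeilRep L e dV hdV hdV0 dW hdW hdW0 χ hχs (borelPlaceMeasure L) ha hsD]
  -- `s^𝔻(ι_v u) = s_f(inclPlace v u)` (★ `cmDoubledWeilRep_locToAdelic`; `finHalf = finSplitting` and `gramDA = T^𝔻 ⊗ 1` definitionally) — by
  -- `congrArg`/`Eq.trans`, not `rw` (rewriting the `Mp(𝕎^𝔻)ᶜᵒⁿᵗ`-valued point makes the closing `rfl` attempt of `rw` time out)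
  exact (congrArg (fun q : MpD L e dV hdV dW hdW => adelicMpCont.omega (Fp L) (Fin (n + n)) (gramDA L e dV hdV dW hdW) q
      (piSchwartzBruhatEquiv (Fp L) (Fin (n + n)) (Φinf ⊗ₜ piProdSB (Fp L) (Fin (n + n)) Y)))
    (cmDoubledWeilRep_locToAdelic L e dV hdV hdV0 dW hdW hdW0 χ hχs (borelPlaceMeasure L) ha v u)).trans (hv u hu Φinf Y hY)

/-! ## §3 The big datum along `tensorEmb`: the Siegel–Weil section of an `M₂`-frame is spherical at almost every place -/

variable {M₂ M' n' : ℕ} (eW : Fin M × Fin M₂ ≃ Fin M') (e' : Fin N × Fin M' ≃ Fin n')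
  (dV' : Fin M₂ → L) (hdV' : ∀ k, IsCMField.complexConj L (dV' k) = dV' k) (hdV'0 : ∀ k, dV' k ≠ 0)

/-- **`ω(sB((ι_v u) ⊗ 1_{V′})) (Φ_∞ ⊗ ⊗_w Φ_w) = Φ_∞ ⊗ ⊗_w Φ_w`** for almost all `v`, all `u ∈ U(𝔻)(𝒪_v)` and all pure tensors with `Φ_v = 𝟙`,
for every `χ`-normalised doubled Weil representation `sB` of the BIG datum `(dV, dW ⊗ dV′)`: `(ι_v u) ⊗ 1 = ι_v u′` with `u′ ∈ U(𝔻 ⊗ V′)(𝒪_v)`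
(★ T2-a `exists_mem_localInt_tensorEmb_inclPlaceAdelic`) and §2 for the big datum.
[cite: GelbartRogawski1991, §3.1 (3.1.3) p. 456] [cite: MoeglinVignerasWaldspurger1987, Chap. 5 I.4] [cite: Kudla1994, §2 (doubled space, Siegel parabolic)] -/
theorem omega_tensorEmb_locToAdelic_tmul_of_isDoubledWeilRep {χ : HeckeCharacter L} (hχu : χ.IsUnitary) (hχs : IsSplittingChar L 1 χ)
    {sB : HA L e' dV hdV (tensorFrame L dW eW dV') (tensorFrame_real L dW hdW eW dV' hdV') →*
      MpD L e' dV hdV (tensorFrame L dW eW dV') (tensorFrame_real L dW hdW eW dV' hdV')}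
    (hsB : IsDoubledWeilRep L e' dV hdV hdV0 (tensorFrame L dW eW dV') (tensorFrame_real L dW hdW eW dV' hdV')
      (tensorFrame_ne_zero L dW eW dV' hdW0 hdV'0) χ sB) :
    ∀ᶠ v in Filter.cofinite, ∀ u ∈ UnitaryGroup.localInt L (IsCMField.complexConj L) (n + n) (hermD L e dV hdV dW hdW) v,
      ∀ (Φinf : SchwartzMap (Fin (n' + n') → mixedSpace (Fp L)) ℂ) (Y : LocalSBFamily (Fp L) (Fin (n' + n'))),
        Y v = unitVec (Fp L) (Fin (n' + n')) v →
          adelicMpCont.omega (Fp L) (Fin (n' + n')) (gramDA L e' dV hdV (tensorFrame L dW eW dV') (tensorFrame_real L dW hdW eW dV' hdV'))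
              (sB (tensorEmb L e dV hdV dW hdW eW e' dV' hdV' (locToAdelic L e dV hdV dW hdW v u)))
              (piSchwartzBruhatEquiv (Fp L) (Fin (n' + n')) (Φinf ⊗ₜ piProdSB (Fp L) (Fin (n' + n')) Y)) =
            piSchwartzBruhatEquiv (Fp L) (Fin (n' + n')) (Φinf ⊗ₜ piProdSB (Fp L) (Fin (n' + n')) Y) := by
  refine (omega_locToAdelic_tmul_of_isDoubledWeilRep L e' dV hdV hdV0 (tensorFrame L dW eW dV') (tensorFrame_real L dW hdW eW dV' hdV')
    (tensorFrame_ne_zero L dW eW dV' hdW0 hdV'0) hχu hχs hsB).mono fun v hv u hu Φinf Y hY => ?_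
  -- `(ι_v u) ⊗ 1 = ι_v u′` with `u′ ∈ U(𝔻 ⊗ V′)(𝒪_v)` (★ T2-a; `locToAdelic = inclPlaceAdelic` definitionally); `Exists.elim` + `congrArg`, not
  -- `obtain` ∕ `rw` (destructuring or rewriting `H(𝔸)`-valued points under `ω(sB ·)` makes `cases` ∕ the closing `rfl` of `rw` time out)
  refine (exists_mem_localInt_tensorEmb_inclPlaceAdelic L e dV hdV dW hdW eW e' dV' hdV' v u hu).elim fun u' hu' => ?_
  exact (congrArg (fun q : HA L e' dV hdV (tensorFrame L dW eW dV') (tensorFrame_real L dW hdW eW dV' hdV') =>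
      adelicMpCont.omega (Fp L) (Fin (n' + n')) (gramDA L e' dV hdV (tensorFrame L dW eW dV') (tensorFrame_real L dW hdW eW dV' hdV'))
        (sB q) (piSchwartzBruhatEquiv (Fp L) (Fin (n' + n')) (Φinf ⊗ₜ piProdSB (Fp L) (Fin (n' + n')) Y))) hu'.2).trans
    (hv u' hu'.1 Φinf Y hY)

/-- **T2-e — THE SIEGEL–WEIL SECTION OF AN `M₂`-FRAME IS SPHERICAL AT ALMOST EVERY PLACE**: for every `χ`-normalised doubled Weil representation
`sB` of the big datum (★ `IsDoubledWeilRep`, `χ` unitary with `χ|_{𝕀_{L⁺}} = ε_{L/L⁺}`), for almost all finite places `v` of `L⁺` (a cofinite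
set depending on `sB` only), all `u ∈ K_{H,v} = U(𝔻)(𝒪_v)`, all pure tensors `Φ = Φ_∞ ⊗ (⊗_w Φ_w)` with `Φ_v = 1_{𝒪_v^{n′+n′}}` and all
`h ∈ H(𝔸)`: `f_Φ^{V′}(h · ι_v u) = f_Φ^{V′}(h)` (★ `swSectionTensor_mul_right` + `omega_tensorEmb_locToAdelic_tmul_of_isDoubledWeilRep`).
[cite: KudlaRallis1994, §1] [cite: HarrisKudlaSweet1996, §1 (1.16)] [cite: GelbartRogawski1991, §3.1 (3.1.3) p. 456] [cite: MoeglinVignerasWaldspurger1987, Chap. 5 I.4] -/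
theorem swSectionTensor_mul_locToAdelic_of_isDoubledWeilRep {χ : HeckeCharacter L} (hχu : χ.IsUnitary) (hχs : IsSplittingChar L 1 χ)
    {sB : HA L e' dV hdV (tensorFrame L dW eW dV') (tensorFrame_real L dW hdW eW dV' hdV') →*
      MpD L e' dV hdV (tensorFrame L dW eW dV') (tensorFrame_real L dW hdW eW dV' hdV')}
    (hsB : IsDoubledWeilRep L e' dV hdV hdV0 (tensorFrame L dW eW dV') (tensorFrame_real L dW hdW eW dV' hdV')
      (tensorFrame_ne_zero L dW eW dV' hdW0 hdV'0) χ sB) :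
    ∀ᶠ v in Filter.cofinite, ∀ u ∈ UnitaryGroup.localInt L (IsCMField.complexConj L) (n + n) (hermD L e dV hdV dW hdW) v,
      ∀ (Φinf : SchwartzMap (Fin (n' + n') → mixedSpace (Fp L)) ℂ) (Y : LocalSBFamily (Fp L) (Fin (n' + n'))),
        Y v = unitVec (Fp L) (Fin (n' + n')) v →
          ∀ h : HA L e dV hdV dW hdW,
            swSectionTensor L e dV hdV dW hdW eW e' dV' hdV' hdV0 hdW0 hdV'0 sB
                (piSchwartzBruhatEquiv (Fp L) (Fin (n' + n')) (Φinf ⊗ₜ piProdSB (Fp L) (Fin (n' + n')) Y))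
                (h * locToAdelic L e dV hdV dW hdW v u) =
              swSectionTensor L e dV hdV dW hdW eW e' dV' hdV' hdV0 hdW0 hdV'0 sB
                (piSchwartzBruhatEquiv (Fp L) (Fin (n' + n')) (Φinf ⊗ₜ piProdSB (Fp L) (Fin (n' + n')) Y)) h :=
  (omega_tensorEmb_locToAdelic_tmul_of_isDoubledWeilRep L e dV hdV hdV0 dW hdW hdW0 eW e' dV' hdV' hdV'0 hχu hχs hsB).mono
    fun v hv u hu Φinf Y hY h => by
      rw [swSectionTensor_mul_right, hv u hu Φinf Y hY]

/-- **the same with no «`Φ_v = 𝟙`» binder**: a restricted family `Y` IS `1_{𝒪_v}` at almost every `v` (★ `RestrictedFamily.eventually_eq`), so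
for FIXED `Φ = Φ_∞ ⊗ (⊗_w Y_w)` the section `f_Φ^{V′}` is right-`K_{H,v}`-invariant for almost all `v`.
[cite: KudlaRallis1994, §1] [cite: GelbartRogawski1991, §3.1 (3.1.3) p. 456] -/
theorem swSectionTensor_mul_locToAdelic_eventually {χ : HeckeCharacter L} (hχu : χ.IsUnitary) (hχs : IsSplittingChar L 1 χ)
    {sB : HA L e' dV hdV (tensorFrame L dW eW dV') (tensorFrame_real L dW hdW eW dV' hdV') →*
      MpD L e' dV hdV (tensorFrame L dW eW dV') (tensorFrame_real L dW hdW eW dV' hdV')}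
    (hsB : IsDoubledWeilRep L e' dV hdV hdV0 (tensorFrame L dW eW dV') (tensorFrame_real L dW hdW eW dV' hdV')
      (tensorFrame_ne_zero L dW eW dV' hdW0 hdV'0) χ sB)
    (Φinf : SchwartzMap (Fin (n' + n') → mixedSpace (Fp L)) ℂ) (Y : LocalSBFamily (Fp L) (Fin (n' + n'))) :
    ∀ᶠ v in Filter.cofinite, ∀ u ∈ UnitaryGroup.localInt L (IsCMField.complexConj L) (n + n) (hermD L e dV hdV dW hdW) v,
      ∀ h : HA L e dV hdV dW hdW,
        swSectionTensor L e dV hdV dW hdW eW e' dV' hdV' hdV0 hdW0 hdV'0 sB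
            (piSchwartzBruhatEquiv (Fp L) (Fin (n' + n')) (Φinf ⊗ₜ piProdSB (Fp L) (Fin (n' + n')) Y))
            (h * locToAdelic L e dV hdV dW hdW v u) =
          swSectionTensor L e dV hdV dW hdW eW e' dV' hdV' hdV0 hdW0 hdV'0 sB
            (piSchwartzBruhatEquiv (Fp L) (Fin (n' + n')) (Φinf ⊗ₜ piProdSB (Fp L) (Fin (n' + n')) Y)) h :=
  ((swSectionTensor_mul_locToAdelic_of_isDoubledWeilRep L e dV hdV hdV0 dW hdW hdW0 eW e' dV' hdV' hdV'0 hχu hχs hsB).and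
      (RestrictedFamily.eventually_eq Y)).mono fun _ hv u hu h => hv.1 u hu Φinf Y hv.2 h

/-- **the representation of record**: for `sB := doubledWeilRep χ` of the big datum (★ `Def411WeilCarriersDoubling.doubledWeilRep`,
★ `isDoubledWeilRep_doubledWeilRep`) the Siegel–Weil section of the `M₂`-frame is spherical at almost every place.
[cite: KudlaRallis1994, §1] [cite: Kudla1994, §2 (doubled space, Siegel parabolic)] [cite: GelbartRogawski1991, §3.1 (3.1.3) p. 456] -/
theorem swSectionTensor_doubledWeilRep_mul_locToAdelic (χ : HeckeCharacter L) (hχu : χ.IsUnitary) (hχs : IsSplittingChar L 1 χ) :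
    ∀ᶠ v in Filter.cofinite, ∀ u ∈ UnitaryGroup.localInt L (IsCMField.complexConj L) (n + n) (hermD L e dV hdV dW hdW) v,
      ∀ (Φinf : SchwartzMap (Fin (n' + n') → mixedSpace (Fp L)) ℂ) (Y : LocalSBFamily (Fp L) (Fin (n' + n'))),
        Y v = unitVec (Fp L) (Fin (n' + n')) v →
          ∀ h : HA L e dV hdV dW hdW,
            swSectionTensor L e dV hdV dW hdW eW e' dV' hdV' hdV0 hdW0 hdV'0
                (doubledWeilRep L e' dV hdV hdV0 (tensorFrame L dW eW dV') (tensorFrame_real L dW hdW eW dV' hdV')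
                  (tensorFrame_ne_zero L dW eW dV' hdW0 hdV'0) χ hχu hχs)
                (piSchwartzBruhatEquiv (Fp L) (Fin (n' + n')) (Φinf ⊗ₜ piProdSB (Fp L) (Fin (n' + n')) Y))
                (h * locToAdelic L e dV hdV dW hdW v u) =
              swSectionTensor L e dV hdV dW hdW eW e' dV' hdV' hdV0 hdW0 hdV'0
                (doubledWeilRep L e' dV hdV hdV0 (tensorFrame L dW eW dV') (tensorFrame_real L dW hdW eW dV' hdV')
                  (tensorFrame_ne_zero L dW eW dV' hdW0 hdV'0) χ hχu hχs)
                (piSchwartzBruhatEquiv (Fp L) (Fin (n' + n')) (Φinf ⊗ₜ piProdSB (Fp L) (Fin (n' + n')) Y)) h :=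
  swSectionTensor_mul_locToAdelic_of_isDoubledWeilRep L e dV hdV hdV0 dW hdW hdW0 eW e' dV' hdV' hdV'0 hχu hχs
    (isDoubledWeilRep_doubledWeilRep L e' dV hdV hdV0 (tensorFrame L dW eW dV') (tensorFrame_real L dW hdW eW dV' hdV')
      (tensorFrame_ne_zero L dW eW dV' hdW0 hdV'0) χ hχu hχs)

end Summit.HodgeConjecture.HodgeConjecture.Cruxes.HLiu418.K2LiuSphericalSWSectionTensor

end
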